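import Mathlib.Analysis.Fourier.FourierTransform
import Mathlib.Analysis.Calculus.ParametricIntegral
import Mathlib.Analysis.Complex.CauchyIntegral
import Mathlib.Analysis.Analytic.Uniqueness
import Literature.Analysis.Fourier.FourierUniquenessL1
import HarnessLib

/-!
# The Fourier transform of a compactly supported integrable function is entire

Topic `Literature/Analysis/Fourier`. The "easy half" of the Paley–Wiener theorem, in the form
needed by compactness arguments such as Bourgain–Dyatlov 2018, Lemma 2.11 ("since `ψ` is compactly
supported, `ψ̂` is real analytic and thus `ψ ≡ 0`"): for `ψ ∈ L¹(ℝ)` vanishing off `[-R, R]`,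
the Fourier–Laplace integral `F(z) = ∫ e^{-2πi z x} ψ(x) dx` is an entire function extending
`ψ̂ = 𝓕 ψ` (Mathlib's convention `𝓕ψ(ξ) = ∫ e^{-2πixξ} ψ(x) dx`), hence `ψ̂` cannot vanish on a
nonempty open interval unless `ψ = 0` a.e. All statements folklore (e.g. Katznelson,
*An introduction to harmonic analysis*, VI.7; Rudin, *Real and complex analysis*, 19.1), proved
here from Mathlib's differentiation under the integral sign, the identity theorem for analytic
functions and the tree's `L¹` Fourier uniqueness (`FourierUniquenessL1.lean`).

* `differentiable_fourierLaplace` — `F` is complex differentiable on `ℂ`;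
* `fourier_eq_fourierLaplace` — `𝓕 ψ ξ = F ξ` for real `ξ`;
* `fourier_eq_zero_of_eqOn_Ioo` — `𝓕 ψ = 0` on `(a, b)`, `a < b` ⇒ `𝓕 ψ = 0` on `ℝ`;
* `ae_eq_zero_of_fourier_eqOn_Ioo` — … ⇒ `ψ = 0` a.e.
-/

namespace Literature.Analysis.Fourier

open _root_.MeasureTheory Set Filter Metric _root_.Complex
open scoped FourierTransform Real Topology

/-- Norm of the Fourier–Laplace kernel: `‖exp(-2πv·z·i)‖ = exp(2π v Im z)`. [folklore] -/
theorem norm_exp_fourierLaplace_kernel (v : ℝ) (z : ℂ) :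
    ‖Complex.exp (((-(2 * π * v) : ℝ) : ℂ) * z * Complex.I)‖ = Real.exp (2 * π * v * z.im) := by
  rw [Complex.norm_exp]
  congr 1
  rw [mul_assoc, Complex.re_ofReal_mul, Complex.mul_I_re]
  ring

/-- Bound on the kernel on `|v| ≤ R`, `|Im z| ≤ B`. [folklore] -/
theorem norm_exp_fourierLaplace_kernel_le {v R B : ℝ} {z : ℂ} (hv : |v| ≤ R) (hz : |z.im| ≤ B) :
    ‖Complex.exp (((-(2 * π * v) : ℝ) : ℂ) * z * Complex.I)‖ ≤ Real.exp (2 * π * R * B) := by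
  rw [norm_exp_fourierLaplace_kernel, Real.exp_le_exp]
  have : v * z.im ≤ R * B := by
    calc v * z.im ≤ |v * z.im| := le_abs_self _
      _ = |v| * |z.im| := abs_mul _ _
      _ ≤ R * B := mul_le_mul hv hz (abs_nonneg _) ((abs_nonneg _).trans hv)
  nlinarith [Real.pi_pos]

/-- **The Fourier–Laplace transform of a compactly supported `L¹` function is entire.**
[folklore] -/
theorem differentiable_fourierLaplace {ψ : ℝ → ℂ} {R : ℝ} (hψ : Integrable ψ) (hR : 0 ≤ R)
    (h0 : ∀ x, x ∉ Icc (-R) R → ψ x = 0) :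
    Differentiable ℂ fun z : ℂ =>
      ∫ v : ℝ, Complex.exp (((-(2 * π * v) : ℝ) : ℂ) * z * Complex.I) * ψ v := by
  intro z₀
  set B : ℝ := |z₀.im| + 1 with hB
  set F : ℂ → ℝ → ℂ := fun z v => Complex.exp (((-(2 * π * v) : ℝ) : ℂ) * z * Complex.I) * ψ v
    with hF
  set F' : ℂ → ℝ → ℂ := fun z v =>
      (((-(2 * π * v) : ℝ) : ℂ) * Complex.I) *
        (Complex.exp (((-(2 * π * v) : ℝ) : ℂ) * z * Complex.I) * ψ v) with hF'
  set bound : ℝ → ℝ := fun v => (2 * π * R * Real.exp (2 * π * R * B)) * ‖ψ v‖ with hbound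
  have hvR : ∀ v, ψ v ≠ 0 → |v| ≤ R := by
    intro v hv
    by_contra h
    exact hv (h0 v fun hmem => h (abs_le.2 ⟨by linarith [hmem.1], hmem.2⟩))
  have hkcont : ∀ z : ℂ, Continuous fun v : ℝ =>
      Complex.exp (((-(2 * π * v) : ℝ) : ℂ) * z * Complex.I) := by
    intro z
    fun_prop
  have hmeas : ∀ z : ℂ, AEStronglyMeasurable (F z) volume := fun z =>
    ((hkcont z).aestronglyMeasurable).mul hψ.aestronglyMeasurable
  have hint : Integrable (F z₀) := by
    refine Integrable.mono' (hψ.norm.const_mul (Real.exp (2 * π * R * B))) (hmeas z₀)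
      (Eventually.of_forall fun v => ?_)
    simp only [hF, norm_mul]
    by_cases hv : ψ v = 0
    · simp [hv]
    · have h1 := norm_exp_fourierLaplace_kernel_le (hvR v hv) (z := z₀) (B := B) (by rw [hB]; linarith)
      exact mul_le_mul_of_nonneg_right h1 (norm_nonneg _)
  have key := hasDerivAt_integral_of_dominated_loc_of_deriv_le (μ := volume) (x₀ := z₀)
    (F := F) (F' := F') (bound := bound) (ball_mem_nhds z₀ zero_lt_one)
    (Eventually.of_forall hmeas) hint ?_ ?_ ?_ ?_
  · exact key.2.differentiableAt
  · simp only [hF']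
    exact ((by fun_prop : Continuous fun v : ℝ =>
      (((-(2 * π * v) : ℝ) : ℂ) * Complex.I)).aestronglyMeasurable).mul (hmeas z₀)
  · refine Eventually.of_forall fun v z hz => ?_
    simp only [hF', hbound, norm_mul, Complex.norm_I, mul_one, Complex.norm_real, Real.norm_eq_abs]
    by_cases hv : ψ v = 0
    · simp [hv]
    · have hzim : |z.im| ≤ B := by
        have h1 : |z.im - z₀.im| ≤ ‖z - z₀‖ := by simpa using abs_im_le_norm (z - z₀)
        have h2 : ‖z - z₀‖ < 1 := mem_ball_iff_norm.1 hz
        calc |z.im| = |z₀.im + (z.im - z₀.im)| := by ring_nf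
          _ ≤ |z₀.im| + |z.im - z₀.im| := abs_add_le _ _
          _ ≤ B := by rw [hB]; linarith
      have hvR' := hvR v hv
      have h1 := norm_exp_fourierLaplace_kernel_le hvR' hzim
      have h2 : |(-(2 * π * v))| ≤ 2 * π * R := by
        rw [abs_neg, abs_mul, abs_of_pos (by positivity : (0 : ℝ) < 2 * π)]
        exact mul_le_mul_of_nonneg_left hvR' (by positivity)
      calc |(-(2 * π * v))| * (‖Complex.exp (((-(2 * π * v) : ℝ) : ℂ) * z * Complex.I)‖ * ‖ψ v‖)
          ≤ (2 * π * R) * (Real.exp (2 * π * R * B) * ‖ψ v‖) := by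
            gcongr
        _ = 2 * π * R * Real.exp (2 * π * R * B) * ‖ψ v‖ := by ring
  · exact hψ.norm.const_mul _
  · refine Eventually.of_forall fun v z _ => ?_
    simp only [hF, hF']
    have h1 : HasDerivAt (fun w : ℂ => (((-(2 * π * v) : ℝ) : ℂ) * w * Complex.I))
        ((((-(2 * π * v) : ℝ) : ℂ) * 1 * Complex.I)) z :=
      ((hasDerivAt_id z).const_mul _).mul_const _
    have h2 := (h1.cexp).mul_const (ψ v)
    exact h2.congr_deriv (by ring)

/-- The Fourier–Laplace integral extends the Fourier transform: `𝓕 ψ ξ = F ξ` for real `ξ`.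
[folklore] -/
theorem fourier_eq_fourierLaplace (ψ : ℝ → ℂ) (ξ : ℝ) :
    𝓕 ψ ξ = ∫ v : ℝ, Complex.exp (((-(2 * π * v) : ℝ) : ℂ) * (ξ : ℂ) * Complex.I) * ψ v := by
  rw [Real.fourier_real_eq_integral_exp_smul]
  congr 1
  funext v
  rw [smul_eq_mul]
  congr 2
  push_cast
  ring

/-- **`𝓕 ψ` vanishing on an open interval vanishes identically**, for `ψ ∈ L¹` with support in
`[-R, R]` (identity theorem for the entire function `F`). [folklore] -/
theorem fourier_eq_zero_of_eqOn_Ioo {ψ : ℝ → ℂ} {R a b : ℝ} (hψ : Integrable ψ) (hR : 0 ≤ R)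
    (h0 : ∀ x, x ∉ Icc (-R) R → ψ x = 0) (hab : a < b)
    (hzero : ∀ ξ ∈ Ioo a b, 𝓕 ψ ξ = 0) (ξ : ℝ) : 𝓕 ψ ξ = 0 := by
  set F : ℂ → ℂ := fun z =>
    ∫ v : ℝ, Complex.exp (((-(2 * π * v) : ℝ) : ℂ) * z * Complex.I) * ψ v with hFdef
  have hFan : AnalyticOnNhd ℂ F univ :=
    (differentiable_fourierLaplace hψ hR h0).differentiableOn.analyticOnNhd isOpen_univ
  set c : ℝ := (a + b) / 2 with hc
  set r : ℝ := (b - a) / 2 with hr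
  have hrpos : 0 < r := by rw [hr]; linarith
  -- real points `c + r/(n+2)` accumulate at `c`
  have hseq : Tendsto (fun n : ℕ => ((c + r / ((n : ℝ) + 2) : ℝ) : ℂ)) atTop (𝓝[≠] (c : ℂ)) := by
    refine tendsto_nhdsWithin_iff.2 ⟨?_, Eventually.of_forall fun n => ?_⟩
    · have h1 : Tendsto (fun n : ℕ => (r / ((n : ℝ) + 2) : ℝ)) atTop (𝓝 0) :=
        tendsto_const_nhds.div_atTop (tendsto_natCast_atTop_atTop.atTop_add tendsto_const_nhds)
      have h2 : Tendsto (fun n : ℕ => (c + r / ((n : ℝ) + 2) : ℝ)) atTop (𝓝 (c + 0)) :=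
        tendsto_const_nhds.add h1
      rw [add_zero] at h2
      exact (Complex.continuous_ofReal.tendsto c).comp h2
    · simp only [mem_compl_iff, mem_singleton_iff, Complex.ofReal_inj]
      have : 0 < r / ((n : ℝ) + 2) := by positivity
      linarith
  have hF : EqOn F 0 univ := by
    refine hFan.eqOn_zero_of_preconnected_of_frequently_eq_zero isPreconnected_univ
      (z₀ := (c : ℂ)) (mem_univ _) ?_
    refine hseq.frequently (Frequently.of_forall fun n => ?_)
    have hmem : c + r / ((n : ℝ) + 2) ∈ Ioo a b := by
      have h1 : 0 < r / ((n : ℝ) + 2) := by positivity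
      have h2 : r / ((n : ℝ) + 2) ≤ r / 2 := by
        apply div_le_div_of_nonneg_left hrpos.le (by norm_num)
        linarith [n.cast_nonneg (α := ℝ)]
      constructor
      · rw [hc]; linarith
      · rw [hc, hr] at *; linarith
    have := hzero _ hmem
    rw [fourier_eq_fourierLaplace] at this
    exact this
  have := hF (mem_univ (ξ : ℂ))
  rw [fourier_eq_fourierLaplace]
  simpa [hFdef] using this

/-- **A compactly supported `L¹` function whose Fourier transform vanishes on an open interval
is zero a.e.** [folklore] -/
theorem ae_eq_zero_of_fourier_eqOn_Ioo {ψ : ℝ → ℂ} {R a b : ℝ} (hψ : Integrable ψ) (hR : 0 ≤ R)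
    (h0 : ∀ x, x ∉ Icc (-R) R → ψ x = 0) (hab : a < b)
    (hzero : ∀ ξ ∈ Ioo a b, 𝓕 ψ ξ = 0) : ψ =ᵐ[volume] 0 :=
  ae_eq_zero_of_forall_fourier_eq_zero hψ (fun ξ => fourier_eq_zero_of_eqOn_Ioo hψ hR h0 hab hzero ξ)

end Literature.Analysis.Fourier
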